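import Literature.Probability.RandomPlanarGeometry.LoopSpaceUniform
import Mathlib.Topology.MetricSpace.HausdorffDistance
import HarnessLib

/-!
# Collections with many separated traces: a robust witness for infinitely many loops

Topic `Literature/Probability/RandomPlanarGeometry`. Bookkeeping on the Aizenman–Burchard space
`LoopSpace E = Closeds (CurveClass E)` used to transfer "there are many macroscopic cluster
boundaries at many scales" from critical percolation to its scaling limits (F. Camia,
C. M. Newman, Comm. Math. Phys. 268 (2006), Thm 2 (ii): almost surely every point is surrounded
by infinitely many loops; the limit law must have infinitely many non-trivial traces, the field
`IsCNLFamily.ae_infinite_traces` of `CLE6.lean`). The event "`L` has `k` members whose traces have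
diameter `≥ ε` and are pairwise at Hausdorff distance `≥ ε`" (`LoopSpace.HasSeparatedTraces`) is
not closed, but:

* `CurveClass.hausdorffDist_range_le_dist` — traces depend `1`-Lipschitz on the curve class for
  the Hausdorff distance (every point of one curve is within `dist` of the other,
  `Curve.infDist_range_le`); diameters of traces then differ by at most twice the distance
  (`CurveClass.diam_range_le`, `LoopSpaceUniform.lean`);
* `LoopSpace.closure_setOf_hasSeparatedTraces_subset` — the closure of the event at level `ε` is
  contained in the event at level `ε / 2` (a nearby collection contains nearby members,
  `exists_edist_lt_of_hausdorffEDist_lt`); this is the form consumed by the closed-set half of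
  the portmanteau theorem;
* `LoopSpace.HasSeparatedTraces.le_encard`, `LoopSpace.infinite_traces_of_forall_hasSeparatedTraces`
  — `k` separated traces of positive diameter are `k` distinct non-trivial traces, so a collection
  with separated families of every size has infinitely many non-trivial traces.

## References

* F. Camia, C. M. Newman, Comm. Math. Phys. 268 (2006), Thm 2 (ii) [CamiaNewman2006].
* M. Aizenman, A. Burchard, Duke Math. J. 99 (1999), §2.1 [AizenmanBurchardDuke1999].
-/

noncomputable section

open Set Metric

namespace Literature.Probability.RandomPlanarGeometry

variable {E : Type*} [MetricSpace E]

/-! ### Traces depend `1`-Lipschitz on the curve class -/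

namespace CurveClass

/-- Every point of the trace of `c` is within `dist c c'` of the trace of `c'`
(Aizenman–Burchard 1999, §2.1). [cite: AizenmanBurchardDuke1999, §2.1] -/
theorem infDist_range_le_dist (c c' : CurveClass E) {x : E} (hx : x ∈ c.range) :
    infDist x c'.range ≤ dist c c' := by
  obtain ⟨γ, rfl⟩ := surjective_mk c
  obtain ⟨γ', rfl⟩ := surjective_mk c'
  obtain ⟨t, rfl⟩ := hx
  exact Curve.infDist_range_le γ γ' t

/-- **The trace is `1`-Lipschitz for the Hausdorff distance**: `d_H(range c, range c') ≤ dist c c'`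
(Aizenman–Burchard 1999, §2.1). [cite: AizenmanBurchardDuke1999, §2.1] -/
theorem hausdorffDist_range_le_dist (c c' : CurveClass E) :
    hausdorffDist c.range c'.range ≤ dist c c' :=
  hausdorffDist_le_of_infDist dist_nonneg (fun _ hx ↦ infDist_range_le_dist c c' hx) fun _ hx ↦ by
    rw [dist_comm]; exact infDist_range_le_dist c' c hx

/-- The Hausdorff extended distance between traces of curve classes is finite (traces are
nonempty and compact). [folklore] -/
theorem hausdorffEDist_range_ne_top (c c' : CurveClass E) : hausdorffEDist c.range c'.range ≠ ⊤ :=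
  hausdorffEDist_ne_top_of_nonempty_of_bounded (range_nonempty c) (range_nonempty c')
    (isCompact_range c).isBounded (isCompact_range c').isBounded

end CurveClass

/-! ### Collections with `k` separated traces -/

namespace LoopSpace

/-- The collection `L` **has `k` `ε`-separated traces**: `k` of its members have traces of
diameter `≥ ε`, pairwise at Hausdorff distance `≥ ε` (the witness, robust under perturbation,
for "at least `k` distinct non-trivial loops"; Camia–Newman 2006, Thm 2 (ii)). [folklore] -/
def HasSeparatedTraces (k : ℕ) (ε : ℝ) (L : LoopSpace E) : Prop :=
  ∃ c : Fin k → CurveClass E, (∀ i, c i ∈ L) ∧ (∀ i, ε ≤ diam (c i).range) ∧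
    ∀ i j, i ≠ j → ε ≤ hausdorffDist (c i).range (c j).range

/-- Monotonicity in the level. [folklore] -/
theorem HasSeparatedTraces.mono {k : ℕ} {ε ε' : ℝ} {L : LoopSpace E} (h : HasSeparatedTraces k ε L)
    (hε : ε' ≤ ε) : HasSeparatedTraces k ε' L := by
  obtain ⟨c, hc, hd, hs⟩ := h
  exact ⟨c, hc, fun i ↦ hε.trans (hd i), fun i j hij ↦ hε.trans (hs i j hij)⟩

/-- **The closure of "`k` `ε`-separated traces" lies in "`k` `ε/2`-separated traces"**
(`ε > 0`): a collection at Hausdorff distance `< ε/8` from one with separated members `c'ᵢ`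
contains members `cᵢ` within `ε/8` of them, whose traces have diameters and mutual Hausdorff
distances smaller by at most `ε/4` (`CurveClass.diam_range_le`,
`CurveClass.hausdorffDist_range_le_dist`). [folklore] -/
theorem closure_setOf_hasSeparatedTraces_subset {k : ℕ} {ε : ℝ} (hε : 0 < ε) :
    closure {L : LoopSpace E | HasSeparatedTraces k ε L} ⊆ {L | HasSeparatedTraces k (ε / 2) L} := by
  intro L hL
  obtain ⟨L', hL', hLL'⟩ := EMetric.mem_closure_iff.1 hL (ENNReal.ofReal (ε / 8)) (by simpa using hε)
  obtain ⟨c', hc', hd', hs'⟩ := hL'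
  -- nearby members of `L`
  have hnear : ∀ i, ∃ c ∈ L, dist (c' i) c < ε / 8 := by
    intro i
    have hH : hausdorffEDist (L' : Set (CurveClass E)) L < ENNReal.ofReal (ε / 8) := by
      rw [← TopologicalSpace.Closeds.edist_eq, edist_comm]; exact hLL'
    obtain ⟨c, hc, hlt⟩ := exists_edist_lt_of_hausdorffEDist_lt (hc' i) hH
    refine ⟨c, hc, ?_⟩
    rwa [edist_dist, ENNReal.ofReal_lt_ofReal_iff (by positivity)] at hlt
  choose c hc hdist using hnear
  refine ⟨c, hc, fun i ↦ ?_, fun i j hij ↦ ?_⟩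
  · have h := CurveClass.diam_range_le (c' i) (c i)
    linarith [hd' i, hdist i]
  · have hfin₁ := CurveClass.hausdorffEDist_range_ne_top (c' i) (c i)
    have hfin₂ := CurveClass.hausdorffEDist_range_ne_top (c' j) (c j)
    have hfin₃ := CurveClass.hausdorffEDist_range_ne_top (c i) (c' j)
    have t1 : hausdorffDist (c' i).range (c' j).range ≤
        hausdorffDist (c' i).range (c i).range + hausdorffDist (c i).range (c' j).range :=
      hausdorffDist_triangle hfin₁
    have t2 : hausdorffDist (c i).range (c' j).range ≤
        hausdorffDist (c i).range (c j).range + hausdorffDist (c j).range (c' j).range :=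
      hausdorffDist_triangle' (by rw [hausdorffEDist_comm]; exact hfin₂)
    have e1 := CurveClass.hausdorffDist_range_le_dist (c' i) (c i)
    have e2 := CurveClass.hausdorffDist_range_le_dist (c j) (c' j)
    rw [dist_comm] at e2
    linarith [hs' i j hij, hdist i, hdist j]

/-- `k` `ε`-separated traces with `ε > 0` are `k` distinct non-trivial traces: the set of traces
of non-trivial members has at least `k` elements. [folklore] -/
theorem HasSeparatedTraces.le_encard {k : ℕ} {ε : ℝ} {L : LoopSpace E} (h : HasSeparatedTraces k ε L)
    (hε : 0 < ε) :
    (k : ℕ∞) ≤ {s : Set E | ∃ c ∈ L, ¬ CurveClass.IsTrivial c ∧ CurveClass.range c = s}.encard := by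
  obtain ⟨c, hc, hd, hs⟩ := h
  have hinj : Function.Injective fun i : Fin k ↦ (c i).range := by
    intro i j hij
    by_contra hne
    have := hs i j hne
    simp only at hij
    rw [hij, hausdorffDist_self_zero] at this
    linarith
  have hmem : ∀ i, (c i).range ∈ {s : Set E | ∃ c ∈ L, ¬ CurveClass.IsTrivial c ∧ CurveClass.range c = s} := by
    intro i
    refine ⟨c i, hc i, fun htriv ↦ ?_, rfl⟩
    have : diam (c i).range = 0 := diam_subsingleton htriv
    linarith [hd i]
  calc (k : ℕ∞) = (Finset.univ.image fun i : Fin k ↦ (c i).range).card := by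
        rw [Finset.card_image_of_injective _ hinj, Finset.card_univ, Fintype.card_fin]
    _ = ((Finset.univ.image fun i : Fin k ↦ (c i).range : Finset (Set E)) : Set (Set E)).encard := by
        rw [encard_coe_eq_coe_finsetCard]
    _ ≤ _ := encard_le_encard fun s hs' ↦ by
        obtain ⟨i, -, rfl⟩ := Finset.mem_image.1 (Finset.mem_coe.1 hs')
        exact hmem i

/-- **Separated families of every size force infinitely many non-trivial traces**: if for every
`k` the collection has `k` `ε_k`-separated traces for some `ε_k > 0`, its set of traces of
non-trivial members is infinite (the witness for `IsCNLFamily.ae_infinite_traces`;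
Camia–Newman 2006, Thm 2 (ii)). [cite: CamiaNewman2006, Thm 2] -/
theorem infinite_traces_of_forall_hasSeparatedTraces {L : LoopSpace E}
    (h : ∀ k : ℕ, ∃ ε : ℝ, 0 < ε ∧ HasSeparatedTraces k ε L) :
    {s : Set E | ∃ c ∈ L, ¬ CurveClass.IsTrivial c ∧ CurveClass.range c = s}.Infinite := by
  refine Set.encard_eq_top_iff.1 (ENat.eq_top_iff_forall_ge.2 fun k ↦ ?_)
  obtain ⟨ε, hε, hk⟩ := h k
  exact hk.le_encard hε

end LoopSpace

end Literature.Probability.RandomPlanarGeometry
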